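import Summits.QuantumFields.QCD.Theorems.NestedDissectionSeaLightQuarkCompletionPhysicalBranchOfFrame
import Summits.QuantumFields.QCD.Theorems.LightQuarkCompletion.Negative.Anatomy

/-!
# Crux `LightQuarkCompletion` (stmt-QuantumFields-18066) — line `Sketch` rev 4, composition B:
# the helper `lightQuarkCompletion_of_chiralCornerPinned`

Registered helper of the lead's skeleton (line `Sketch`, rev 4, crux stmt-QuantumFields-18066, route NestedDissectionSea):
composition B closes the crux `Summit.QuantumFields.QCD.Theses.NestedDissectionSea.LightQuarkCompletion` BY NAME from
three hypotheses, each taken as an explicit premise (nothing is asserted unconditionally):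

* the frame (α) of the route crux `FrameAndSeparatorLaw` (item stmt-QuantumFields-17012), abbreviated in the tree as
  `FrameAndSeparatorLawNegative.Frame` — through the landed `physicalBranch_of_frame` it gives `m_crit → 0` for every
  threshold-pinned regularisation of `N_f ∈ {2,3}`;
* the text of the sibling item `HeavyThresholdYMBridge.ChiralCompletion` (stmt-QuantumFields-17661), verbatim: from
  `HasMassScaling` and the `QCDOf` body above some threshold `M₀`, ONE constant RGI re-pin `δ` of the critical mass
  (`reg.scheme (fun f => m f + δ)`) makes the regularisation chiral at zero and carries the body at every positive tuple;
* `ChiralCornerPinned`: for a regularisation carrying the crux's threshold package `HypAt Nf reg M₀`, every offset `δ` at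
  which the up-shift `upShift reg δ` (`m_crit ↦ m_crit + a δ / Z_m`, Negative `Anatomy`) is chiral at zero and carries the
  body at every positive tuple also carries the two-sided parity pin at ZERO threshold.

The proof is bookkeeping over the landed Negative `Anatomy` (`lightQuarkCompletion_iff`, `upShift_scheme`,
`hasMassScaling_upShift`, `hasAsymptoticScaling_upShift`, `tendsto_mcrit_upShift`): the δ-re-pinned scheme of item 17661
IS the scheme of `upShift reg δ`, so the witness is `reg' := upShift reg δ`.  Pure logic; no definition introduced; no
Theses decl is asserted.
-/

noncomputable section

namespace Summit.QuantumFields.QCD.Theorems.LightQuarkJumpLine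

open MeasureTheory Filter Topology
open Literature.MathematicalPhysics.QuantumFieldTheory Literature.MathematicalPhysics.QuantumLattice
  Literature.Probability.LatticeModels
open Summit.QuantumFields.QCD.Theorems.CoerciveSeaNegative (PinClause)
open Summit.QuantumFields.QCD.Theorems.EarlyCrosserLawNegative (UpperPin)
open Summit.QuantumFields.QCD.Theorems.FrameAndSeparatorLawNegative (Frame)
open Summit.QuantumFields.QCD.Theorems.LightQuarkCompletion.Negative
  (PinPkg Body HypAt Concl upShift lightQuarkCompletion_iff upShift_scheme hasMassScaling_upShift
    hasAsymptoticScaling_upShift tendsto_mcrit_upShift)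

/-- The δ-re-pinned scheme of item 17661, `reg.scheme (fun f => m f + δ)`, IS the scheme of the up-shift `upShift reg δ`
at the tuple `m` (Negative `upShift_scheme`, up to `m f + δ = δ + m f`). [folklore] -/
private theorem scheme_shift_eq_upShift_scheme {Nf : ℕ} (reg : QCDRegularisation Nf) (δ : ℝ) (m : Fin Nf → ℝ)
    (z shift : QCDField Nf → ℕ → ℝ) :
    reg.scheme (fun f => m f + δ) z shift = (upShift reg δ).scheme m z shift := by
  rw [upShift_scheme]
  congr 1
  funext f
  ring

/-- **The crux along line `Sketch`, composition B** (registered helper; pure bookkeeping, conclusion = the route decl BY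
NAME, no subsequence).  From the frame (α) (`Frame`, item 17012), the verbatim text of `HeavyThresholdYMBridge.ChiralCompletion`
(item 17661) and `ChiralCornerPinned` (the chiral corner of a threshold-pinned regularisation carries the two-sided pin at zero
threshold), the crux `LightQuarkCompletion` follows.  Given the threshold package at `(reg, M₀)`: item 17661 gives `δ` with
`upShift reg δ` chiral at zero and carrying the body at every positive tuple (`scheme_shift_eq_upShift_scheme`);
`ChiralCornerPinned` gives its two-sided pin at zero threshold; both scalings survive the up-shift (`hasMassScaling_upShift`,
`hasAsymptoticScaling_upShift`); (α) through `physicalBranch_of_frame` gives `m_crit → 0` for `reg`, hence for `upShift reg δ`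
(`tendsto_mcrit_upShift`, `N_f ≤ 16`).  Witness: `reg' := upShift reg δ`. [folklore] -/
theorem lightQuarkCompletion_of_chiralCornerPinned :
    Summit.QuantumFields.QCD.Theorems.FrameAndSeparatorLawNegative.Frame →
    (∀ Nf : ℕ, Nf = 2 ∨ Nf = 3 → ∀ (reg : QCDRegularisation Nf) (M₀ : ℝ), reg.HasMassScaling →
      (∀ m : Fin Nf → ℝ, (∀ f, M₀ < m f) → ∃ (z shift : QCDField Nf → ℕ → ℝ) (T : OSData (QCDField Nf) 4),
        IsQCDAlong (reg.scheme m z shift) T ∧ T.IsNontrivial QCDField.glue ∧ T.IsNonGaussian QCDField.glue ∧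
          (∀ f g : Fin Nf, f ≠ g → T.IsNontrivial (QCDField.pseudoRe f g)) ∧
            ∃ Δ > 0, T.HasMassGap Δ ∧ (reg.scheme m z shift).HasLatticeMassGap Δ) →
      ∃ δ : ℝ, (∀ ε > (0 : ℝ), ∃ m : Fin Nf → ℝ, (∀ f, 0 < m f) ∧
          ¬ (reg.scheme (fun f => m f + δ) 0 0).HasLatticeMassGap ε) ∧
        ∀ m : Fin Nf → ℝ, (∀ f, 0 < m f) → ∃ (z shift : QCDField Nf → ℕ → ℝ) (T : OSData (QCDField Nf) 4),
          IsQCDAlong (reg.scheme (fun f => m f + δ) z shift) T ∧ T.IsNontrivial QCDField.glue ∧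
            T.IsNonGaussian QCDField.glue ∧ (∀ f g : Fin Nf, f ≠ g → T.IsNontrivial (QCDField.pseudoRe f g)) ∧
              ∃ Δ > 0, T.HasMassGap Δ ∧ (reg.scheme (fun f => m f + δ) z shift).HasLatticeMassGap Δ) →
    (∀ Nf : ℕ, (Nf = 2 ∨ Nf = 3) → ∀ (reg : QCDRegularisation Nf) (M₀ : ℝ),
      Summit.QuantumFields.QCD.Theorems.LightQuarkCompletion.Negative.HypAt Nf reg M₀ → ∀ δ : ℝ,
        (Summit.QuantumFields.QCD.Theorems.LightQuarkCompletion.Negative.upShift reg δ).IsChiralAtZero →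
          Summit.QuantumFields.QCD.Theorems.LightQuarkCompletion.Negative.Body Nf
            (Summit.QuantumFields.QCD.Theorems.LightQuarkCompletion.Negative.upShift reg δ) 0 →
          Summit.QuantumFields.QCD.Theorems.LightQuarkCompletion.Negative.PinPkg Nf
            (Summit.QuantumFields.QCD.Theorems.LightQuarkCompletion.Negative.upShift reg δ) 0) →
    Summit.QuantumFields.QCD.Theses.NestedDissectionSea.LightQuarkCompletion := by
  intro hF hCC hCP
  rw [lightQuarkCompletion_iff]
  intro Nf hNf reg M₀ hH
  obtain ⟨hMS, hAS, hbr, hM₀, hpin, hbody⟩ := hH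
  have hNf16 : Nf ≤ 16 := by rcases hNf with rfl | rfl <;> norm_num
  -- item 17661: the chiral corner `δ`, with the body at every positive tuple
  obtain ⟨δ, hχ, hbodyδ⟩ := hCC Nf hNf reg M₀ hMS hbody
  have hχ' : (upShift reg δ).IsChiralAtZero := by
    intro ε hε
    obtain ⟨m, hm, hng⟩ := hχ ε hε
    refine ⟨m, hm, ?_⟩
    rwa [← scheme_shift_eq_upShift_scheme]
  have hbody' : Body Nf (upShift reg δ) 0 := by
    intro m hm
    obtain ⟨z, shift, T, hQ, hN, hG, hP, Δ, hΔ, hT, hL⟩ := hbodyδ m hm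
    refine ⟨z, shift, T, ?_, hN, hG, hP, Δ, hΔ, hT, ?_⟩
    · rwa [← scheme_shift_eq_upShift_scheme]
    · rwa [← scheme_shift_eq_upShift_scheme]
  -- the one missing clause: the zero-threshold pin at the chiral corner
  have hpin' : PinPkg Nf (upShift reg δ) 0 := hCP Nf hNf reg M₀ ⟨hMS, hAS, hbr, hM₀, hpin, hbody⟩ δ hχ' hbody'
  -- the physical branch from the frame (α), transported through the up-shift
  have hlim : Tendsto reg.mcrit atTop (𝓝 0) := physicalBranch_of_frame hF Nf hNf reg hMS hAS M₀ hM₀ hpin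
  exact ⟨upShift reg δ, (hasMassScaling_upShift reg δ).2 hMS, (hasAsymptoticScaling_upShift reg δ).2 hAS,
    tendsto_mcrit_upShift reg δ hNf16 hMS hlim, hpin', hχ', hbody'⟩

end Summit.QuantumFields.QCD.Theorems.LightQuarkJumpLine

end
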